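import Literature.AlgebraicTopology.Homotopy.WeaklyContractibleManifold
import Literature.AlgebraicTopology.SingularHomology.HurewiczVanishing
import Literature.AlgebraicTopology.SingularHomology.HurewiczVanishingProofs
import Literature.AlgebraicTopology.SingularHomology.HomotopyAdditionProofs
import HarnessLib

/-!
# Whitehead–Hurewicz for manifolds: proofs (reductions of the named fact to the Hurewicz leaf)

Topic `Literature/AlgebraicTopology/Homotopy`, sibling proof file of `WhiteheadContractible.lean`,
whose named fact `Literature.AlgebraicTopology.Homotopy.Manifold.contractibleSpace_of_simplyConnected_of_acyclic`
(Bredon, *Topology and Geometry* (1993), VII Cor. 10.11 with Milnor 1959, Cor. 1: a simply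
connected Hausdorff second countable topological `n`-manifold with `Hₖ(M; ℤ) = 0` for `k ≥ 1` is
contractible) is to be discharged here. State of the discharge:

* the "Whitehead + Milnor" half is PROVED in the tree without any named fact:
  `Literature.AlgebraicTopology.Homotopy.Manifold.contractibleSpace_of_subsingleton_homotopyGroup`
  (`WeaklyContractibleManifold.lean`: a weakly contractible manifold is contractible, by a direct
  chart-by-chart grid construction);
* the remaining input is the Hurewicz theorem in its **vanishing form**
  `Literature.AlgebraicTopology.SingularHomology.hurewicz_subsingleton` (`HurewiczVanishing.lean`;
  Hatcher, *Algebraic Topology* (2002), Thm. 4.32 at the zero group), a named fact weaker than the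
  isomorphism clause `hurewicz_iso` used by the earlier reduction
  `Manifold.contractibleSpace_of_simplyConnected_of_acyclic_of_hurewicz`.

This file proves the reduction to that weaker leaf, and then the fact itself:

* `Literature.AlgebraicTopology.Homotopy.Manifold.contractibleSpace_of_simplyConnected_of_acyclic_of_hurewiczSubsingleton`:
  `hurewicz_subsingleton → Manifold.contractibleSpace_of_simplyConnected_of_acyclic`;
* `Literature.AlgebraicTopology.Homotopy.Manifold.contractibleSpace_of_simplyConnected_of_acyclic_holds`:
  **the named fact is DISCHARGED** — `hurewicz_subsingleton` follows from
  `SingularHomology.hurewicz_subsingleton_of_homotopyAddition` (`HurewiczVanishingProofs.lean`: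
  Spanier's proof of the Hurewicz theorem from the Eilenberg retraction,
  `EilenbergRetractionProofs.lean`, given homotopy addition data) fed with
  `SingularHomology.homotopyAddition_holds` (`HomotopyAdditionProofs.lean`, the homotopy addition
  theorem; the tree also proves the same nullity for compactly supported spheres,
  `CSphere.prod_toClass_hat_face`, `SimplexBoundaryProduct.lean`). No named fact remains in
  the closure.

## References

* G. E. Bredon, *Topology and Geometry*, GTM 139 (1993), Ch. VII, Cor. 10.10, Cor. 10.11
  (printed p. 479). [Bredon1993]
* A. Hatcher, *Algebraic Topology*, CUP (2002), §4.2, Thm. 4.32. [HatcherAT2002]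
* J. Milnor, *On spaces having the homotopy type of a CW-complex*, Trans. AMS 90 (1959), Cor. 1.
  [Milnor1959]
-/

noncomputable section

open CategoryTheory Limits
open scoped Topology

universe u

namespace Literature.AlgebraicTopology.Homotopy

namespace Manifold

/-- **The Whitehead–Hurewicz recognition principle for manifolds, GIVEN only the vanishing form
of the Hurewicz theorem.** The named fact `Manifold.contractibleSpace_of_simplyConnected_of_acyclic`
(Bredon 1993, VII Cor. 10.11 with Milnor 1959, Cor. 1) follows from
`SingularHomology.hurewicz_subsingleton` (Hatcher 2002, Thm. 4.32 at `Hₙ = 0`; Bredon VII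
Cor. 10.10): a simply connected acyclic space then has all homotopy groups trivial
(`SingularHomology.subsingleton_homotopyGroup_of_isZero_singularHomology_of_subsingleton`), and a
weakly contractible manifold is contractible (`contractibleSpace_of_subsingleton_homotopyGroup`,
proved). [cite: Bredon1993, Ch. VII Cor. 10.10 and Cor. 10.11] -/
theorem contractibleSpace_of_simplyConnected_of_acyclic_of_hurewiczSubsingleton
    (h : SingularHomology.hurewicz_subsingleton.{u}) :
    Manifold.contractibleSpace_of_simplyConnected_of_acyclic.{u} := by
  intro n M _ _ _ _ _ hac
  exact contractibleSpace_of_subsingleton_homotopyGroup n M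
    (SingularHomology.subsingleton_homotopyGroup_of_isZero_singularHomology_of_subsingleton h hac)

end Manifold

/-- **Bredon 1993, VII Cor. 10.11 with Milnor 1959, Cor. 1 — DISCHARGED.** A simply connected
Hausdorff second countable topological `n`-manifold with `Hₖ(M; ℤ) = 0` for all `k ≥ 1` is
contractible: `π₁ = 0` and `H̃_* = 0` give `π_* = 0` by the Hurewicz vanishing theorem (Bredon VII
Cor. 10.10; here `SingularHomology.hurewicz_subsingleton_of_homotopyAddition` — the Eilenberg
retraction argument — with `SingularHomology.homotopyAddition_holds`), and a weakly contractible
manifold is contractible (`contractibleSpace_of_subsingleton_homotopyGroup`, which replaces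
Whitehead's theorem plus Milnor's CW-type theorem in Bredon's proof of Cor. 10.11 by a direct
chart-by-chart construction). [cite: Bredon1993, Ch. VII Cor. 10.10 and Cor. 10.11 (p. 479)] -/
theorem Manifold.contractibleSpace_of_simplyConnected_of_acyclic_holds :
    Manifold.contractibleSpace_of_simplyConnected_of_acyclic.{u} :=
  Manifold.contractibleSpace_of_simplyConnected_of_acyclic_of_hurewiczSubsingleton
    (SingularHomology.hurewicz_subsingleton_of_homotopyAddition SingularHomology.homotopyAddition_holds)

end Literature.AlgebraicTopology.Homotopy

end
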